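import Summits.Ventures.CertifiedManyBodySolver.Downfold.OneBandBox
import Literature.MathematicalPhysics.QuantumLattice.HubbardTTPrimeTPPInteraction
import HarnessLib

/-!
# The S1/S2 seam in the `t''` direction: words about the `t–t'` object (E) transported to the
# `t–t'–t''` object (M) of a one-band box through a Lipschitz constant in `t''/t`

Venture CertifiedManyBodySolver, cell `pub/hubbard-downfold` (stage S1), seat hubbard-downfold-mod-1;
namespace `Summit.Ventures.CertifiedManyBodySolver.Downfold`. Everything here is PROVED. HONEST FRAMING:
a downfolded box is a systematic modelling claim (hypothesis `B.Mem p`); the certified content is the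
word on the cell and the Lipschitz constant; the generic constant `8` below is the operator-norm one
(coarse: `8 · |t''/t| ≈ 0.7–1.0` for the cuprate boxes of record), the sharp kinematic constant is the
robustness seats' business and plugs into the same rule (`holdsOn_inflate_of_lipschitz`).

Context (`router/BOX-SCHEMA.md` §1/§8, lead ruling 2026-08-26T18:45Z «object tags», hubbard-fast-p1
`TPP-DIRECTION.md` v1.0 (T1)/(T3)). A material's one-band block carries TWO one-body objects: M = the
Wannier Hamiltonian truncated at printed range (`t, t', t'', …`; box coordinate `tpp/t`) and E = the
`t–t'` refit; stage S2 certifies words about the `t–t'` family. The only generic transfer E → M is for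
ENERGY words, by a modulus of continuity in `t''`:

* `holdsOn_oneBand_of_cell₄` — the seam reading FOUR entries (`tp/t`, `tpp/t`, `U/t`, `n`): a word about
  the `t ≡ 1` family `H(1, s, s'', u)` at filling `n` proved on the product cell holds on the box.
* `Entry.abs_le_of_mem` — `|x| ≤ max |lo| |hi|` on an entry's enclosure (the `tpp/t` magnitude `m`).
* `holdsOn_inflate_of_lipschitz` — THE (T1) RULE, generic: if `s'' ↦ f p s''` is `C`-Lipschitz at `0`
  for every parameter vector `p` and the E-word `L ≤ f p 0 ≤ R` holds on the box, then the M-word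
  `L − C·m ≤ f p (p tppOverT) ≤ R + C·m` holds on the box (`m = max |tpp/t lo| |tpp/t hi|`).
* `holdsOn_tiGroundEnergyDensity_objectM` — the rule instantiated with the tree's `t–t'–t''` interaction
  (`Literature/…/HubbardTTPrimeTPPInteraction`: `hubbardTT'T''FermionInteraction 1 s s'' u` IS the pencil
  in `s''`, `|e₀(s'') − e₀(0)| ≤ 8|s''|` at range parameter `2`): an S2 window `[L, R]` for the
  translation-invariant ground-state energy density of the `t–t'` interaction on the `(tp/t, U/t)` cell
  becomes the window `[L − 8m, R + 8m]` for the `t–t'–t''` interaction on the box — «e₀ (object M,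
  one-body truncation inflated)» in the cell's vocabulary. (TI-inf level = unconstrained infimum over
  translation-invariant states; the filling-constrained twin is the same two lines once S2 states its
  words for a constrained infimum.)
-/

namespace Summit.Ventures.CertifiedManyBodySolver.Downfold

open NonemptyInterval Literature.MathematicalPhysics.QuantumLattice

/-- **The S1/S2 seam with the `tpp/t` entry.** Let the one-band box `B` carry entries `eS, eSS, eU, eN`
for `tp/t`, `tpp/t`, `U/t`, `n`, and let `W₁ s s'' u n` be a word about the `t ≡ 1` family
`H(1, s, s'', u)` at filling `n` proved on the product cell of the four enclosures. Then
`p ↦ W₁ (p tpOverT) (p tppOverT) (p UOverT) (p filling)` holds on `B`. [folklore] -/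
theorem holdsOn_oneBand_of_cell₄ {B : OneBandBox} {eS eSS eU eN : Entry}
    (hS : B .tpOverT = some eS) (hSS : B .tppOverT = some eSS) (hU : B .UOverT = some eU)
    (hN : B .filling = some eN) {W₁ : ℝ → ℝ → ℝ → ℝ → Prop}
    (hW : ∀ s s'' u n : ℝ, s ∈ eS.encl.ratCast ℝ → s'' ∈ eSS.encl.ratCast ℝ → u ∈ eU.encl.ratCast ℝ →
      n ∈ eN.encl.ratCast ℝ → W₁ s s'' u n) :
    HoldsOn (fun p : OneBandCoord → ℝ => W₁ (p .tpOverT) (p .tppOverT) (p .UOverT) (p .filling)) B :=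
  fun _ hp => hW _ _ _ _ (hp _ _ hS) (hp _ _ hSS) (hp _ _ hU) (hp _ _ hN)

/-- **The magnitude of an entry**: every `x` in the claimed enclosure `[lo, hi]` has
`|x| ≤ max |lo| |hi|`. [folklore] -/
theorem Entry.abs_le_of_mem {e : Entry} {x : ℝ} (hx : e.Mem x) :
    |x| ≤ ((max |e.encl.fst| |e.encl.snd| : ℚ) : ℝ) := by
  have h := mem_ratCast_iff.1 hx
  push_cast
  exact abs_le_max_abs_abs h.1 h.2

/-- **The (T1) rule: an E-word plus a Lipschitz constant in `t''/t` is an M-word.** Let `B` carry the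
entry `eSS` for `tpp/t`, let `f p s''` be `C`-Lipschitz at `s'' = 0` for every parameter vector `p`
(`|f p s'' − f p 0| ≤ C|s''|`, `C ≥ 0`), and let the window `L ≤ f p 0 ≤ R` hold on `B`. Then
`L − C·m ≤ f p (p tppOverT) ≤ R + C·m` holds on `B`, `m = max |eSS.lo| |eSS.hi|`. [folklore] -/
theorem holdsOn_inflate_of_lipschitz {B : OneBandBox} {eSS : Entry} (hSS : B .tppOverT = some eSS)
    {f : (OneBandCoord → ℝ) → ℝ → ℝ} {C : ℝ} (hC0 : 0 ≤ C)
    (hC : ∀ (p : OneBandCoord → ℝ) (s'' : ℝ), |f p s'' - f p 0| ≤ C * |s''|) {L R : ℝ}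
    (hE : HoldsOn (fun p : OneBandCoord → ℝ => L ≤ f p 0 ∧ f p 0 ≤ R) B) :
    HoldsOn (fun p : OneBandCoord → ℝ =>
      L - C * ((max |eSS.encl.fst| |eSS.encl.snd| : ℚ) : ℝ) ≤ f p (p .tppOverT) ∧
        f p (p .tppOverT) ≤ R + C * ((max |eSS.encl.fst| |eSS.encl.snd| : ℚ) : ℝ)) B := by
  intro p hp
  have hm : |p .tppOverT| ≤ ((max |eSS.encl.fst| |eSS.encl.snd| : ℚ) : ℝ) :=
    Entry.abs_le_of_mem (hp _ _ hSS)
  have hCm : C * |p .tppOverT| ≤ C * ((max |eSS.encl.fst| |eSS.encl.snd| : ℚ) : ℝ) :=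
    mul_le_mul_of_nonneg_left hm hC0
  have hL := abs_le.1 ((hC p (p .tppOverT)).trans hCm)
  obtain ⟨h1, h2⟩ := hE p hp
  constructor <;> linarith [hL.1, hL.2]

/-- **«e₀ (object M, one-body truncation inflated)» — the rule instantiated with the tree's
`t–t'–t''` interaction.** Let `B` carry entries `eS, eSS, eU` for `tp/t`, `tpp/t`, `U/t`, and let S2
certify the window `L ≤ e₀(H(1, s, u)) ≤ R` for the translation-invariant ground-state energy density
(range parameter `2`) of the `t–t'` interaction on the cell `eS.encl × eU.encl` (object E). Then on the
box the `t–t'–t''` interaction `H(1, s, s'', u)` (object M restricted to `t, t', t''`) has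
`L − 8m ≤ e₀ ≤ R + 8m`, `m = max |eSS.lo| |eSS.hi|` (generic Lipschitz constant `8` of
`abs_tiGroundEnergyDensity_tpp_sub_le_eight_mul`). [folklore] -/
theorem holdsOn_tiGroundEnergyDensity_objectM {B : OneBandBox} {eS eSS eU : Entry}
    (hS : B .tpOverT = some eS) (hSS : B .tppOverT = some eSS) (hU : B .UOverT = some eU) {L R : ℝ}
    (hE : ∀ s u : ℝ, s ∈ eS.encl.ratCast ℝ → u ∈ eU.encl.ratCast ℝ →
      L ≤ (hubbardTTPrimeFermionInteraction 1 s u).tiGroundEnergyDensity 2 ∧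
        (hubbardTTPrimeFermionInteraction 1 s u).tiGroundEnergyDensity 2 ≤ R) :
    HoldsOn (fun p : OneBandCoord → ℝ =>
      L - 8 * ((max |eSS.encl.fst| |eSS.encl.snd| : ℚ) : ℝ) ≤
          (hubbardTT'T''FermionInteraction 1 (p .tpOverT) (p .tppOverT) (p .UOverT)).tiGroundEnergyDensity 2 ∧
        (hubbardTT'T''FermionInteraction 1 (p .tpOverT) (p .tppOverT) (p .UOverT)).tiGroundEnergyDensity 2 ≤
          R + 8 * ((max |eSS.encl.fst| |eSS.encl.snd| : ℚ) : ℝ)) B := by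
  refine holdsOn_inflate_of_lipschitz hSS
    (f := fun p s'' => (hubbardTT'T''FermionInteraction 1 (p .tpOverT) s'' (p .UOverT)).tiGroundEnergyDensity 2)
    (by norm_num) (fun p s'' => ?_) ?_
  · have h := abs_tiGroundEnergyDensity_tpp_sub_le_eight_mul 1 (p .tpOverT) s'' (p .UOverT) 0
    rwa [sub_zero] at h
  · refine holdsOn_oneBand_of_cell₂ hS hU (W₁ := fun s u =>
      L ≤ (hubbardTT'T''FermionInteraction 1 s 0 u).tiGroundEnergyDensity 2 ∧
        (hubbardTT'T''FermionInteraction 1 s 0 u).tiGroundEnergyDensity 2 ≤ R) fun s u hs hu => ?_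
    rw [hubbardTT'T''FermionInteraction_zero]
    exact hE s u hs hu

/-! ### Appendix (2026-08-26, append-only): the seam in S2's own shape with the fourth coordinate —
`θ ∈ Set.Icc lo hi ⊆ (Fin 4 → ℝ)`, order `(U/t, t'/t, t''/t, n)`

An S2 anchor class WITH `t''` in the Hamiltonian (hubbard-fast-p1 TPP-DIRECTION v1.1 §6.2 «M-COVER»)
states its box words as `∀ θ ∈ Set.Icc lo hi, W θ` over `Fin 4 → ℝ`; these three declarations attach
such a word to a material box exactly as `S2Seam.lean` does for the three `t–t'` coordinates. -/

/-- A one-band parameter vector read in S2's four-coordinate order `(U/t, t'/t, t''/t, n)`. [folklore] -/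
def s2Coords₄ (p : OneBandCoord → ℝ) : Fin 4 → ℝ := ![p .UOverT, p .tpOverT, p .tppOverT, p .filling]

/-- Lower corner of the delivered four-coordinate S2 box from the `U/t`, `tp/t`, `tpp/t`, `n` entries. [folklore] -/
def s2Lo₄ (eU eS eSS eN : Entry) : Fin 4 → ℝ :=
  ![((eU.encl.fst : ℚ) : ℝ), ((eS.encl.fst : ℚ) : ℝ), ((eSS.encl.fst : ℚ) : ℝ), ((eN.encl.fst : ℚ) : ℝ)]

/-- Upper corner of the delivered four-coordinate S2 box from the `U/t`, `tp/t`, `tpp/t`, `n` entries. [folklore] -/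
def s2Hi₄ (eU eS eSS eN : Entry) : Fin 4 → ℝ :=
  ![((eU.encl.snd : ℚ) : ℝ), ((eS.encl.snd : ℚ) : ℝ), ((eSS.encl.snd : ℚ) : ℝ), ((eN.encl.snd : ℚ) : ℝ)]

/-- The four S2 coordinates of `s2Coords₄ p`, by name. [folklore] -/
theorem s2Coords₄_apply (p : OneBandCoord → ℝ) :
    s2Coords₄ p 0 = p .UOverT ∧ s2Coords₄ p 1 = p .tpOverT ∧ s2Coords₄ p 2 = p .tppOverT ∧
      s2Coords₄ p 3 = p .filling :=
  ⟨rfl, rfl, rfl, rfl⟩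

/-- **The delivered four-coordinate box of a one-band box.** If `B` carries entries `eU, eS, eSS, eN` for
`U/t`, `tp/t`, `tpp/t`, `n`, every parameter vector of `B`, read in the order `(U/t, t'/t, t''/t, n)`,
lies in `Set.Icc (s2Lo₄ …) (s2Hi₄ …)`. [folklore] -/
theorem s2Coords₄_mem_Icc {B : OneBandBox} {eU eS eSS eN : Entry} (hU : B .UOverT = some eU)
    (hS : B .tpOverT = some eS) (hSS : B .tppOverT = some eSS) (hN : B .filling = some eN)
    {p : OneBandCoord → ℝ} (hp : B.Mem p) :
    s2Coords₄ p ∈ Set.Icc (s2Lo₄ eU eS eSS eN) (s2Hi₄ eU eS eSS eN) := by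
  have hu := mem_ratCast_iff.1 (hp _ _ hU)
  have hs := mem_ratCast_iff.1 (hp _ _ hS)
  have hss := mem_ratCast_iff.1 (hp _ _ hSS)
  have hn := mem_ratCast_iff.1 (hp _ _ hN)
  rw [Set.mem_Icc, Pi.le_def, Pi.le_def]
  refine ⟨fun k => ?_, fun k => ?_⟩ <;> fin_cases k <;>
    simp [s2Coords₄, s2Lo₄, s2Hi₄, hu.1, hu.2, hs.1, hs.2, hss.1, hss.2, hn.1, hn.2]

/-- **Four-coordinate S2 box statement ⇒ box word.** Any statement `∀ θ ∈ Set.Icc (s2Lo₄ …) (s2Hi₄ …), W θ`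
about the delivered box (the conclusion shape of a covering theorem of an anchor class with `t''`) holds
on the one-band box as `p ↦ W (s2Coords₄ p)`. [folklore] -/
theorem holdsOn_of_forall_s2Box₄ {B : OneBandBox} {eU eS eSS eN : Entry} (hU : B .UOverT = some eU)
    (hS : B .tpOverT = some eS) (hSS : B .tppOverT = some eSS) (hN : B .filling = some eN)
    {W : (Fin 4 → ℝ) → Prop}
    (hW : ∀ θ ∈ Set.Icc (s2Lo₄ eU eS eSS eN) (s2Hi₄ eU eS eSS eN), W θ) :
    HoldsOn (fun p : OneBandCoord → ℝ => W (s2Coords₄ p)) B :=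
  fun _ hp => hW _ (s2Coords₄_mem_Icc hU hS hSS hN hp)

/-- **Forgetting `t''`**: a word certified on the four-coordinate box that does not read coordinate `2`
is a word on the three `t–t'` coordinates `(U/t, t'/t, n)` of the same parameter vector — the E-frame
reading of an M-frame certificate (projection, no loss). [folklore] -/
theorem holdsOn_s2Coords_of_s2Coords₄ {B : OneBandBox} {W₃ : ℝ → ℝ → ℝ → Prop}
    (h : HoldsOn (fun p : OneBandCoord → ℝ => W₃ (s2Coords₄ p 0) (s2Coords₄ p 1) (s2Coords₄ p 3)) B) :
    HoldsOn (fun p : OneBandCoord → ℝ => W₃ (p .UOverT) (p .tpOverT) (p .filling)) B :=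
  fun p hp => h p hp

end Summit.Ventures.CertifiedManyBodySolver.Downfold
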